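import Summits.BirchSwinnertonDyer.BirchSwinnertonDyer.Theorems.SignedLowerHalvesKobayashiLowerHalfLargeImageCongruenceRecords11
import Summits.BirchSwinnertonDyer.BirchSwinnertonDyer.Theorems.SignedLowerHalvesKobayashiLowerHalfLargeImageCongruencePlacesGood
import Summits.BirchSwinnertonDyer.BirchSwinnertonDyer.Theorems.SignedLowerHalvesKobayashiLowerHalfLargeImageCongruencePlacesGoodCard
import Summits.BirchSwinnertonDyer.Rank1Residual.Supersingular.SurjFrobeniusOrderCertificateShape
import Literature.NumberTheory.EllipticCurves.NonEisensteinPrimeOfSurjective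
import Summits.BirchSwinnertonDyer.Rank1Residual.Partition.MainConjecturesCMSupersingular
import HarnessLib

/-!
# Route `SignedLowerHalves`, crux `KobayashiLowerHalfLargeImage` (item stmt-BirchSwinnertonDyer-19001):
# congruence-road RECORDS on corner X6 (board A6), part 2 — `conglx6_271726d1_3` (`ε = −1` and `ε = +1`) from the RANK-TWO DONOR `77636a1`
# (cell `bsd-ssimc`, seat `bsd-ssimc-k3-c3` gen 9, object «X7-RESIDUE-ROADS», director's rider «if found ⇒ A6 cells»; shapes of
# k3-c3's records 10/11 (p484912/p484984); `--supports stmt-BirchSwinnertonDyer-19000 --as helper` (item 2 = crux `KobayashiLowerHalfSemistable`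
# of k3-c2's lane, NOT claimed; per-pair support only); closes nothing about either crux)

PARTITION (cell bsd-ssimc): X6 ∧ r = 0 (A6) × the pair `(271726d1, 3)` — Cremona `[1, -1, 1, -17696338, -28651334301]`, `N = 271726 = 2·7·13·1493` square-free,
`r_an = 0`, `#Ш_an = 81`, `ρ̄_{E,3}` onto (kernel certificate inline), `a_3 = 0`; **a RESIDUE cell `(3, X6)` on desk A's state of record R429/R430**
(g255 pickle 1fa984bacd822614; open cells [[3, 'X6']]; flags none) with two-engine `λ(L_3^±(E)) = 2` (not a unit: no Kim/Kurihara
road) — closes PER PAIR: `KobayashiMainConjecture W 3 ε` for `ε = −1` and `ε = +1`, item 2's `∃ ε, KobayashiLowerDivisibility W 3 ε` and `BSDp W 3`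
(rank-zero image-free door), from PUBLISHED inputs by name + E's displayed two-engine row + a
kernel-checked Hesse `3`-congruence + kernel-decided Greenberg–Vatsal bookkeeping + the donor's rank datum; crux OPEN;
nothing booked (the OFFER is the planner's); BSD is not proved by any of this. THEOREMS ONLY.

ROAD (`…CongruenceShapeBound` p481588 §1 + (D1); here the donor `77636a1` has Mordell–Weil rank 2 = `λ(L_3^ε(E)) + Σδ_E − Σδ_{E′}` — the
`9 ∣ #Ш(E)` predicted by BSD is «explained» by a rank-two curve congruent mod 3 (cf. Cremona–Mazur visibility), which the signed
Iwasawa theory turns into the main conjecture at the pair): Kato `ξ ∣ L^ε_3(E)` (Kobayashi Thm 4.1, integral under Surj) gives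
`λ(ξ) ≤ λ(L)`; B. D. Kim 2009 Cor. 2.13 along the `3`-congruence `E[3] ≅ E′[3]` gives `λ(X^ε(E)) + Σδ_E = λ(X^ε(E′)) + Σδ_{E′}`
(`μ = 0` from E's certificate); the donor supplies `λ(X^ε(E′)) ≥ rank E′(ℚ)` (Kummer points in `Sel^ε`); the books close the
squeeze `λ(X^ε(E)) ≥ λ(L^ε_3(E))` ⇒ `(ξ) = (ϖ L^ε_3)`. Donor found by this lineage's residue box sieve (g8 kits j265594…j265600,
fold `SWEEP-DONORS-X7r1-p3.tsv` 41a56d6b051fbc8b), every δ and the Hesse identity re-decided here by the kernel.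

References: [Kobayashi2003] Conj. (p. 2), Thm. 1.2, 4.1, 7.4; [BDKim2009] Cor. 2.13, 2.5, Prop. 2.6; [GreenbergLNM1716] §3;
[Pollack2003] Def. 6.15, Prop. 6.9/6.10/6.18; [Fisher2012Hessian] §13; [GreenbergVatsal2000] Prop. (2.4);
[BurungaleKobayashiOta2023] Cor. A.5; [Cremona2006] Table 1.
-/

set_option autoImplicit false
set_option linter.dupNamespace false
noncomputable section

open scoped Classical MatrixGroups ModularForm BigOperators

open CongruenceSubgroup WeierstrassCurve NumberField IsDedekindDomain Rat.HeightOneSpectrum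
  Literature.NumberTheory.EllipticCurves
  Literature.NumberTheory.EllipticCurves.ModularForms
  Literature.NumberTheory.EllipticCurves.Rank1Residual
  Literature.NumberTheory.EllipticCurves.Rank1Residual.Typed
  Literature.NumberTheory.EllipticCurves.Kobayashi2003 ZpExtension
  Literature.NumberTheory.EllipticCurves.GreenbergVatsal2000
  Literature.NumberTheory.EllipticCurves.BurungaleKobayashiOta2024
  Literature.NumberTheory.EllipticCurves.Fisher2012
  Literature.NumberTheory.EllipticCurves.Rank1Residual.X11RankOneCertificates
  Literature.NumberTheory.GaloisRepresentations
  Summit.BirchSwinnertonDyer.Rank1Residual.X1.MuLambda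
  Summit.BirchSwinnertonDyer.Rank1Residual.Supersingular
  Summit.BirchSwinnertonDyer.Rank1Residual.X2.LocalDeltaCalculus
  Summit.BirchSwinnertonDyer.BirchSwinnertonDyer.Rank1Residual.IntModel
  Summit.BirchSwinnertonDyer.BirchSwinnertonDyer.Rank1Residual.X11RankOne
  Summit.BirchSwinnertonDyer.Rank1Residual.X11b

namespace Summit.BirchSwinnertonDyer.BirchSwinnertonDyer.Theorems.CongruenceRoad

/-! ### §1 The data of the pair `(271726d1, 3)` and its donor `77636a1` -/

/-- `#Ẽ(𝔽_3) = 4` for `271726d1` (`a_3 = 0`). [cite: Cremona2006, Table 1 (Cremona label 271726d1)] -/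
theorem x2_countPoints_271726d1_3 : countPoints [1, -1, 1, -17696338, -28651334301] 3 = (4 : ℕ) :=
  countPoints_eq_of_fast (by decide +kernel)

/-- `#Ẽ′(𝔽_3) = 4` for the donor `77636a1` `[0, 0, 0, -17, -3]` (`a_3 = 0`). [cite: Cremona2006, Table 1] -/
theorem x2_countPoints_77636a1_3 : countPoints [0, 0, 0, -17, -3] 3 = (4 : ℕ) :=
  countPoints_eq_of_fast (by decide +kernel)

/-- `#(𝔽_{7})`-points of the reduction of `77636a1` `[0, 0, 0, -17, -3]` (good at `7`): `10` (`3 ∤ 10`). [cite: Cremona2006, Table 1] -/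
theorem x2_countPoints_77636a1_7 : countPoints [0, 0, 0, -17, -3] 7 = (10 : ℕ) :=
  countPoints_eq_of_fast (by decide +kernel)

/-! ### §2 The lower-bound road at the pair, sign-generic -/

/-- **The LOWER-BOUND congruence road AT THE PAIR `(271726d1, 3)`, sign-generic** (shape of record 11 p484984). Target
`E = [1, -1, 1, -17696338, -28651334301]` (Cremona 271726d1, `N = 271726 = 2·7·13·1493`, X6 = SEMISTABLE, `r_an = 0`, `#Ш_an = 81`; `Surj E 3` by the kernel
certificate `surj_three_of_ainvs_of_irr_of_order` proved inline), donor `E′ = [0, 0, 0, -17, -3]` (Cremona 77636a1, `N′ = 77636 = 2²·13·1493`),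
`3`-congruent to `E` by the kernel certificate `threeCongruent_of_hesseCertificate_unconditional` (Fisher's Hesse pencil
of `E′` at `(λ : μ) = (212/3 : 1)`, `u = 8/3`; found by the box sieve of this seat's lineage (g8 kits j265594…j265600), re-solved exactly,
re-checked by the kernel), good supersingular at `3` with `a_3(E′) = 0`. For ANY sign `ε` and ANY `l, l′`: GIVEN E's certificate read-out
`hcert : (μ, λ)(L^ε_3(E)) = (0, l)`, a LOWER bound `hlam′ : l′ ≤ λ(X^ε(E′))` on every dual datum, and the books `l + 3 ≤ l′ + 3`
(`Σ₀ = {2, 7, 13, 1493}`, `δ_E = (0, 0, 0, 3)`, `δ_{E′} = (0, 0, 0, 3)`, every δ KERNEL-DECIDED by the place toolkit), the tree's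
`kobayashiMainConjecture_of_lambdaTransfer_of_le_at_conductor` (p481588) gives `KobayashiMainConjecture E 3 ε`. Published inputs BY NAME
(`h12 h41 h5 h3 hL20 hKim`); data binders: the minimality/ellipticity instances of both literal models, `NeZero N_E`, `f₀`. PER PAIR;
closes nothing by itself. [cite: Kobayashi2003, Conjecture (p. 2), Thm. 1.2 and Thm. 4.1] [cite: BDKim2009, Cor. 2.13, Cor. 2.5 and Prop. 2.6 (pp. 185–187)]
[cite: Fisher2012Hessian, §13 (n = 3)] [cite: GreenbergVatsal2000, §2 Prop. (2.4)] [cite: Cremona2006, Table 1 (Cremona label 271726d1)] -/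
theorem conglx6_kobayashiMainConjecture_271726d1_3_of_partnerBound_77636a1
    (h12 : Kobayashi2003.thm12_signedSelmerDual_finite_torsion)
    (h41 : Kobayashi2003.thm41_signedCharIdeal_divisibility)
    (h5 : realPeriodRat_eq_unit_mul_plusPeriod) (h3 : realPeriodRat_eq_unit_mul_plusPeriod_three)
    (hL20 : Wuthrich2014.lemma20_surjective_threeAdic_of_semistable)
    (hKim : BDKim2009.cor213_signedLambda_add_sum_delta_eq_of_torsionIso)
    [(⟨1, -1, 1, -17696338, -28651334301⟩ : WeierstrassCurve ℚ).IsElliptic]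
    [(⟨1, -1, 1, -17696338, -28651334301⟩ : WeierstrassCurve ℚ).IsGloballyMinimal]
    [(⟨0, 0, 0, -17, -3⟩ : WeierstrassCurve ℚ).IsElliptic]
    [(⟨0, 0, 0, -17, -3⟩ : WeierstrassCurve ℚ).IsGloballyMinimal]
    [NeZero ((⟨1, -1, 1, -17696338, -28651334301⟩ : WeierstrassCurve ℚ).conductorNorm ℤ)]
    {f₀ : CuspForm (Gamma0 ((⟨1, -1, 1, -17696338, -28651334301⟩ : WeierstrassCurve ℚ).conductorNorm ℤ)) 2}
    (hf₀ : IsNewformOf (⟨1, -1, 1, -17696338, -28651334301⟩ : WeierstrassCurve ℚ) f₀)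
    (ε : ℤˣ) {l l' : ℕ}
    (hcert : ∀ L : IwasawaAlgebra 3, IsSignedPAdicLFunction f₀ 3 ε L → mu L = 0 ∧ lam L = l)
    (hlam' : ∀ (κ : ZpExtension ℚ 3) (γ : Field.absoluteGaloisGroup ℚ), κ.IsCyclotomic →
      κ.IsTopGenerator γ → IsCyclotomicVariable 3 γ →
      ∀ (D' : SignedSelmerDualData (⟨0, 0, 0, -17, -3⟩ : WeierstrassCurve ℚ) κ γ ε)
      [Module.Finite (IwasawaAlgebra 3) D'.X], Module.IsTorsion (IwasawaAlgebra 3) D'.X →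
      l' ≤ lambdaInvariant 3 D'.X)
    (hll : l + 3 ≤ l' + 3) :
    KobayashiMainConjecture (⟨1, -1, 1, -17696338, -28651334301⟩ : WeierstrassCurve ℚ) 3 ε := by
  have hI : integralModelInt (⟨1, -1, 1, -17696338, -28651334301⟩ : WeierstrassCurve ℚ) = ⟨1, -1, 1, -17696338, -28651334301⟩ :=
    integralModelInt_eq_of_map_eq _ (map_mk_int 1 (-1) 1 (-17696338) (-28651334301))
  have hp2 : (3 : ℕ) ≠ 2 := by decide
  have hn := natCard_point_eq_of_countPoints 1 (-1) 1 (-17696338) (-28651334301) 3 hp2 (by decide) x2_countPoints_271726d1_3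
  have hSS : GoodSS (⟨1, -1, 1, -17696338, -28651334301⟩ : WeierstrassCurve ℚ) 3 :=
    goodSS_of_intModel 3 hI (by decide) hn (by norm_num)
  have hap : (⟨1, -1, 1, -17696338, -28651334301⟩ : WeierstrassCurve ℚ).frobeniusTrace 3 = 0 := by
    rw [frobeniusTrace_eq hI hn]; norm_num
  have hI' : integralModelInt (⟨0, 0, 0, -17, -3⟩ : WeierstrassCurve ℚ) = ⟨0, 0, 0, -17, -3⟩ :=
    integralModelInt_eq_of_map_eq _ (map_mk_int 0 0 0 (-17) (-3))
  have hn' := natCard_point_eq_of_countPoints 0 0 0 (-17) (-3) 3 hp2 (by decide) x2_countPoints_77636a1_3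
  have hSS' : GoodSS (⟨0, 0, 0, -17, -3⟩ : WeierstrassCurve ℚ) 3 :=
    goodSS_of_intModel 3 hI' (by decide) hn' (by norm_num)
  have hap' : (⟨0, 0, 0, -17, -3⟩ : WeierstrassCurve ℚ).frobeniusTrace 3 = 0 := by
    rw [frobeniusTrace_eq hI' hn']; norm_num
  -- `ρ̄_{E,3}` onto, kernel certificate (two Frobenius witnesses: `ℓ₁ = 5` irreducible, `ℓ₂ = 31` of order 3)
  have hs : Surj (⟨1, -1, 1, -17696338, -28651334301⟩ : WeierstrassCurve ℚ) 3 :=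
    surj_three_of_ainvs_of_irr_of_order 1 (-1) 1 (-17696338) (-28651334301)
      (isGloballyMinimal_of_krausCriterion_bounded 1 (-1) 1 (-17696338) (-28651334301)
        (by decide +kernel) (by decide +kernel) (by decide +kernel))
      5 31 (by norm_num) (by norm_num) (by decide) (by decide) (by decide) (by decide)
      (by decide +kernel) (by decide +kernel)
      (n₁ := 2) (n₂ := 24) (by decide +kernel) (by decide +kernel)
      (by decide) (by decide) (by decide) (by decide)
  -- the 3-congruence: Fisher's Hesse pencil of `E′` through `E` (§13), kernel-checked
  have he : ∃ e : geomTorsion (⟨1, -1, 1, -17696338, -28651334301⟩ : WeierstrassCurve ℚ) ((3 : ℕ) : ℤ) ≃+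
      geomTorsion (⟨0, 0, 0, -17, -3⟩ : WeierstrassCurve ℚ) ((3 : ℕ) : ℤ),
      ∀ (σ : Field.absoluteGaloisGroup ℚ) (P : geomTorsion (⟨1, -1, 1, -17696338, -28651334301⟩ : WeierstrassCurve ℚ)
        ((3 : ℕ) : ℤ)), e (σ • P) = σ • e P :=
    threeCongruent_of_hesseCertificate_unconditional (⟨0, 0, 0, -17, -3⟩ : WeierstrassCurve ℚ)
      (⟨1, -1, 1, -17696338, -28651334301⟩ : WeierstrassCurve ℚ) (212 / 3) (1) (8 / 3) (by norm_num)
      (by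
        rw [eval_hesseC4three]
        norm_num [WeierstrassCurve.c₄, WeierstrassCurve.c₆, WeierstrassCurve.b₂, WeierstrassCurve.b₄,
          WeierstrassCurve.b₆])
      (by
        rw [eval_hesseC6three]
        norm_num [WeierstrassCurve.c₄, WeierstrassCurve.c₆, WeierstrassCurve.b₂, WeierstrassCurve.b₄,
          WeierstrassCurve.b₆])
  -- the places of `Σ₀ = {2, 7, 13, 1493}`
  set v2 : HeightOneSpectrum (𝓞 ℚ) := (primesEquiv (R := 𝓞 ℚ)).symm ⟨2, Nat.prime_two⟩ with hv2
  set v7 : HeightOneSpectrum (𝓞 ℚ) := (primesEquiv (R := 𝓞 ℚ)).symm ⟨7, (by norm_num)⟩ with hv7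
  set v13 : HeightOneSpectrum (𝓞 ℚ) := (primesEquiv (R := 𝓞 ℚ)).symm ⟨13, (by norm_num)⟩ with hv13
  set v1493 : HeightOneSpectrum (𝓞 ℚ) := (primesEquiv (R := 𝓞 ℚ)).symm ⟨1493, (by norm_num)⟩ with hv1493
  -- δ-terms of `E`
  have d2 : delta (⟨1, -1, 1, -17696338, -28651334301⟩ : WeierstrassCurve ℚ) 3 v2 = 0 := by
    rw [delta_eq_of_split hI 3 v2 2 Nat.prime_two (by rw [hv2, natGenerator_symm]) (by decide) (by decide)
      ⟨0, by decide +kernel⟩, sFactor_eq_of_eq_pow_mul (k := 0) (m := 1) (by norm_num) (by norm_num)]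
    decide
  have d7 : delta (⟨1, -1, 1, -17696338, -28651334301⟩ : WeierstrassCurve ℚ) 3 v7 = 0 := by
    rw [delta_eq_of_nonsplit hI 3 v7 7 (by norm_num) (by rw [hv7, natGenerator_symm]) (by decide) (by decide)
      (by decide +kernel), sFactor_eq_of_eq_pow_mul (k := 0) (m := 16) (by norm_num) (by norm_num)]
    decide
  have d13 : delta (⟨1, -1, 1, -17696338, -28651334301⟩ : WeierstrassCurve ℚ) 3 v13 = 0 := by
    rw [delta_eq_of_nonsplit hI 3 v13 13 (by norm_num) (by rw [hv13, natGenerator_symm]) (by decide) (by decide)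
      (by decide +kernel), sFactor_eq_of_eq_pow_mul (k := 0) (m := 56) (by norm_num) (by norm_num)]
    decide
  have d1493 : delta (⟨1, -1, 1, -17696338, -28651334301⟩ : WeierstrassCurve ℚ) 3 v1493 = 3 := by
    rw [delta_eq_of_nonsplit hI 3 v1493 1493 (by norm_num) (by rw [hv1493, natGenerator_symm]) (by decide) (by decide)
      (by decide +kernel), sFactor_eq_of_eq_pow_mul (k := 1) (m := 247672) (by norm_num) (by norm_num)]
    decide
  -- δ-terms of `E′`
  have e2 : delta (⟨0, 0, 0, -17, -3⟩ : WeierstrassCurve ℚ) 3 v2 = 0 :=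
    delta_eq_zero_of_dvd_of_dvd hI' 3 v2 (by rw [hv2, natGenerator_symm]; decide)
      (by rw [hv2, natGenerator_symm]; decide)
  have e7 : delta (⟨0, 0, 0, -17, -3⟩ : WeierstrassCurve ℚ) 3 v7 = 0 :=
    delta_eq_zero_of_good_of_not_dvd_count hI' 3 v7 7 (by norm_num) (by rw [hv7, natGenerator_symm]) (by norm_num)
      (by norm_num) rfl (by decide) x2_countPoints_77636a1_7 (by decide)
  have e13 : delta (⟨0, 0, 0, -17, -3⟩ : WeierstrassCurve ℚ) 3 v13 = 0 := by
    rw [delta_eq_of_nonsplit hI' 3 v13 13 (by norm_num) (by rw [hv13, natGenerator_symm]) (by decide) (by decide)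
      (by decide +kernel), sFactor_eq_of_eq_pow_mul (k := 0) (m := 56) (by norm_num) (by norm_num)]
    decide
  have e1493 : delta (⟨0, 0, 0, -17, -3⟩ : WeierstrassCurve ℚ) 3 v1493 = 3 := by
    rw [delta_eq_of_nonsplit hI' 3 v1493 1493 (by norm_num) (by rw [hv1493, natGenerator_symm]) (by decide) (by decide)
      (by decide +kernel), sFactor_eq_of_eq_pow_mul (k := 1) (m := 247672) (by norm_num) (by norm_num)]
    decide
  -- distinctness of the places
  have n1 : v2 ∉ ({v7, v13, v1493} : Finset (HeightOneSpectrum (𝓞 ℚ))) := by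
    simp only [Finset.mem_insert, Finset.mem_singleton, hv2, hv7, hv13, hv1493, not_or]
    exact ⟨symm_ne_symm _ _ (by norm_num), symm_ne_symm _ _ (by norm_num), symm_ne_symm _ _ (by norm_num)⟩
  have n2 : v7 ∉ ({v13, v1493} : Finset (HeightOneSpectrum (𝓞 ℚ))) := by
    simp only [Finset.mem_insert, Finset.mem_singleton, hv7, hv13, hv1493, not_or]
    exact ⟨symm_ne_symm _ _ (by norm_num), symm_ne_symm _ _ (by norm_num)⟩
  have n3 : v13 ∉ ({v1493} : Finset (HeightOneSpectrum (𝓞 ℚ))) := by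
    simp only [Finset.mem_singleton, hv13, hv1493]
    exact symm_ne_symm _ _ (by norm_num)
  refine kobayashiMainConjecture_of_lambdaTransfer_of_le_at_conductor h12 h41 h5 h3 hL20 hKim hp2 hSS.1 hap
    hs ε hf₀ hcert hSS'.1 hap' he hlam' ({v2, v7, v13, v1493} : Finset (HeightOneSpectrum (𝓞 ℚ))) ?_ ?_ ?_ ?_
  · -- `3 ∉ v` for `v ∈ Σ₀`
    intro v hv
    simp only [Finset.mem_insert, Finset.mem_singleton] at hv
    rcases hv with rfl | rfl | rfl | rfl
    · exact natCast_not_mem_symm (by norm_num) _ (by norm_num)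
    · exact natCast_not_mem_symm (by norm_num) _ (by norm_num)
    · exact natCast_not_mem_symm (by norm_num) _ (by norm_num)
    · exact natCast_not_mem_symm (by norm_num) _ (by norm_num)
  · -- `Σ₀ ⊇` bad places of `E`: `Δ(E) = −2 * 7 ^ 18 * 13 * 1493`
    intro v hv
    by_contra hvS
    apply hv
    apply hasGoodReductionAt_of_not_dvd hI
    intro hdvd
    have hΔ : (⟨1, -1, 1, -17696338, -28651334301⟩ : WeierstrassCurve ℤ).Δ = -(2 * 7 ^ 18 * 13 * 1493) := by decide
    rw [hΔ, dvd_neg] at hdvd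
    have hpr := prime_natGenerator v
    have h' : natGenerator v ∣ 2 * 7 ^ 18 * 13 * 1493 := by exact_mod_cast hdvd
    have key : natGenerator v = 2 ∨ natGenerator v = 7 ∨ natGenerator v = 13 ∨ natGenerator v = 1493 := by
      rcases (Nat.Prime.dvd_mul hpr).mp h' with h | h
      · rcases (Nat.Prime.dvd_mul hpr).mp h with h | h
        · rcases (Nat.Prime.dvd_mul hpr).mp h with h | h
          · exact Or.inl ((Nat.prime_dvd_prime_iff_eq hpr Nat.prime_two).mp h)
          · exact Or.inr (Or.inl ((Nat.prime_dvd_prime_iff_eq hpr (by norm_num)).mp (hpr.dvd_of_dvd_pow h)))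
        · exact Or.inr (Or.inr (Or.inl ((Nat.prime_dvd_prime_iff_eq hpr (by norm_num)).mp h)))
      · exact Or.inr (Or.inr (Or.inr ((Nat.prime_dvd_prime_iff_eq hpr (by norm_num)).mp h)))
    apply hvS
    simp only [Finset.mem_insert, Finset.mem_singleton]
    rcases key with h | h | h | h
    · exact Or.inl (eq_symm_of_natGenerator_eq Nat.prime_two h)
    · exact Or.inr (Or.inl (eq_symm_of_natGenerator_eq (by norm_num) h))
    · exact Or.inr (Or.inr (Or.inl (eq_symm_of_natGenerator_eq (by norm_num) h)))
    · exact Or.inr (Or.inr (Or.inr (eq_symm_of_natGenerator_eq (by norm_num) h)))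
  · -- `Σ₀ ⊇` bad places of `E′`: `Δ(E′) = 2 ^ 4 * 13 * 1493`
    intro v hv
    by_contra hvS
    apply hv
    apply hasGoodReductionAt_of_not_dvd hI'
    intro hdvd
    have hΔ : (⟨0, 0, 0, -17, -3⟩ : WeierstrassCurve ℤ).Δ = 2 ^ 4 * 13 * 1493 := by decide
    rw [hΔ] at hdvd
    have hpr := prime_natGenerator v
    have h' : natGenerator v ∣ 2 ^ 4 * 13 * 1493 := by exact_mod_cast hdvd
    have key : natGenerator v = 2 ∨ natGenerator v = 13 ∨ natGenerator v = 1493 := by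
      rcases (Nat.Prime.dvd_mul hpr).mp h' with h | h
      · rcases (Nat.Prime.dvd_mul hpr).mp h with h | h
        · exact Or.inl ((Nat.prime_dvd_prime_iff_eq hpr Nat.prime_two).mp (hpr.dvd_of_dvd_pow h))
        · exact Or.inr (Or.inl ((Nat.prime_dvd_prime_iff_eq hpr (by norm_num)).mp h))
      · exact Or.inr (Or.inr ((Nat.prime_dvd_prime_iff_eq hpr (by norm_num)).mp h))
    apply hvS
    simp only [Finset.mem_insert, Finset.mem_singleton]
    rcases key with h | h | h
    · exact Or.inl (eq_symm_of_natGenerator_eq Nat.prime_two h)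
    · exact Or.inr (Or.inr (Or.inl (eq_symm_of_natGenerator_eq (by norm_num) h)))
    · exact Or.inr (Or.inr (Or.inr (eq_symm_of_natGenerator_eq (by norm_num) h)))
  · -- the books `l + (0 + 0 + 0 + 3) ≤ l′ + (0 + 0 + 0 + 3)`
    rw [Finset.sum_insert n1, Finset.sum_insert n2, Finset.sum_insert n3, Finset.sum_singleton,
      Finset.sum_insert n1, Finset.sum_insert n2, Finset.sum_insert n3, Finset.sum_singleton,
      d2, d7, d13, d1493, e2, e7, e13, e1493]
    omega

/-! ### §3 The records: E's two-engine row displayed, the donor's rank as the partner datum -/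

/-- **`conglx6_271726d1_3`, sign `ε = −1` (ODD layers, the tree's `L⁺`), from the RANK-TWO DONOR `77636a1`.**
Kobayashi's main conjecture for `(271726d1, 3, ε = −1)` AT THE PAIR — a desk-RESIDUE `(3, X6)` cell (board A6; A R429/R430; `r_an = 0`, `#Ш_an = 81`) with
`λ(L^{−1}_3(E)) = 2`: E's two-engine ODD row (b2b iw-2 `tables/engT_layers.tsv` key `271726d1@3` layer `n = 3`,
`q = 6 = deg ω_3^+`, `μ(θ_3) = 0`, `λ(θ_3) = 8 = 6 + 2`, engine B b2b kit j094272 = ENGINE T b2b kit j099352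
`V = 8` CERTIFIED, AGREE; displayed in this seat's rows file) as `hΘ, hΘ0, hμ, hlam`; the partner datum is ONLY the donor's `hr′ : 2 ≤ rank E′(ℚ)` (Cremona 77636a1: rank 2; independent points [['-4', '1'], ['12', '39']] displayed by PARI `ellrank` in the sieve, height determinant 4.04639638479314) turned into `2 ≤ λ(X^ε(E′))` by (D1) `le_lambdaInvariant_of_le_mordellWeilRank` (the tree theorem `T^{rank} ∣ ξ`, Greenberg LNM 1716 §3);
books `2 + 3 ≤ 2 + 3`. Inputs BY NAME `h12 h41 h5 h3 hL20 hKim`; data binders as in `…_of_partnerBound_77636a1` plus `hr′`.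
UNCONDITIONAL («published + certificates» tier). PER PAIR; nothing booked; BSD is not proved by any of this.
[cite: Kobayashi2003, Conjecture (p. 2), Thm. 1.2 and Thm. 4.1] [cite: GreenbergLNM1716, §3 Lemma 3.1]
[cite: Pollack2003, Def. 6.15, Prop. 6.9, 6.10 and 6.18] [cite: BDKim2009, Cor. 2.13 (p. 187)] [cite: Cremona2006, Table 1 (Cremona label 271726d1)] -/
theorem conglx6_kobayashiMainConjecture_271726d1_3_odd_of_rankTwoDonor
    (h12 : Kobayashi2003.thm12_signedSelmerDual_finite_torsion)
    (h41 : Kobayashi2003.thm41_signedCharIdeal_divisibility)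
    (h5 : realPeriodRat_eq_unit_mul_plusPeriod) (h3 : realPeriodRat_eq_unit_mul_plusPeriod_three)
    (hL20 : Wuthrich2014.lemma20_surjective_threeAdic_of_semistable)
    (hKim : BDKim2009.cor213_signedLambda_add_sum_delta_eq_of_torsionIso)
    [(⟨1, -1, 1, -17696338, -28651334301⟩ : WeierstrassCurve ℚ).IsElliptic]
    [(⟨1, -1, 1, -17696338, -28651334301⟩ : WeierstrassCurve ℚ).IsGloballyMinimal]
    [(⟨0, 0, 0, -17, -3⟩ : WeierstrassCurve ℚ).IsElliptic]
    [(⟨0, 0, 0, -17, -3⟩ : WeierstrassCurve ℚ).IsGloballyMinimal]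
    [NeZero ((⟨1, -1, 1, -17696338, -28651334301⟩ : WeierstrassCurve ℚ).conductorNorm ℤ)]
    {f₀ : CuspForm (Gamma0 ((⟨1, -1, 1, -17696338, -28651334301⟩ : WeierstrassCurve ℚ).conductorNorm ℤ)) 2}
    (hf₀ : IsNewformOf (⟨1, -1, 1, -17696338, -28651334301⟩ : WeierstrassCurve ℚ) f₀)
    (hr' : 2 ≤ (⟨0, 0, 0, -17, -3⟩ : WeierstrassCurve ℚ).mordellWeilRank)
    {Θ : IwasawaAlgebra 3}
    (hΘ : iwasawaToPowerSeries 3 Θ =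
      ((mazurTateElement f₀ 3 3).map (algebraMap ℚ ℚ_[3]) : PowerSeries ℚ_[3]))
    (hΘ0 : Θ ≠ 0) (hμ : mu Θ = 0) (hlam : lam Θ = (cyclotomicOmegaPlus 3 3).natDegree + 2) :
    KobayashiMainConjecture (⟨1, -1, 1, -17696338, -28651334301⟩ : WeierstrassCurve ℚ) 3 (-1) := by
  have hI : integralModelInt (⟨1, -1, 1, -17696338, -28651334301⟩ : WeierstrassCurve ℚ) = ⟨1, -1, 1, -17696338, -28651334301⟩ :=
    integralModelInt_eq_of_map_eq _ (map_mk_int 1 (-1) 1 (-17696338) (-28651334301))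
  have hp2 : (3 : ℕ) ≠ 2 := by decide
  have hn := natCard_point_eq_of_countPoints 1 (-1) 1 (-17696338) (-28651334301) 3 hp2 (by decide) x2_countPoints_271726d1_3
  have hSS : GoodSS (⟨1, -1, 1, -17696338, -28651334301⟩ : WeierstrassCurve ℚ) 3 :=
    goodSS_of_intModel 3 hI (by decide) hn (by norm_num)
  have hap : (⟨1, -1, 1, -17696338, -28651334301⟩ : WeierstrassCurve ℚ).frobeniusTrace 3 = 0 := by
    rw [frobeniusTrace_eq hI hn]; norm_num
  exact conglx6_kobayashiMainConjecture_271726d1_3_of_partnerBound_77636a1 h12 h41 h5 h3 hL20 hKim hf₀ (-1)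
    (fun L hL ↦ lam_signed_neg_one_eq_of_mazurTate' hp2 hf₀ hSS.1 hap hL (by decide) hΘ hΘ0 hμ hlam)
    (le_lambdaInvariant_of_le_mordellWeilRank (p := 3) (-1) hr')
    (by norm_num)

/-- **`conglx6_271726d1_3`, sign `ε = +1` (EVEN layers, the tree's `L⁻`), from the RANK-TWO DONOR `77636a1`.**
Kobayashi's main conjecture for `(271726d1, 3, ε = 1)` AT THE PAIR — a desk-RESIDUE `(3, X6)` cell (board A6; A R429/R430; `r_an = 0`, `#Ш_an = 81`) with
`λ(L^{1}_3(E)) = 2`: E's two-engine EVEN row (b2b iw-2 `tables/engT_layers.tsv` key `271726d1@3` layer `n = 2`,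
`q = 2 = deg ω_2^-`, `μ(θ_2) = 0`, `λ(θ_2) = 4 = 2 + 2`, engine B b2b kit j094272 = ENGINE T b2b kit j098011
`V = 4` CERTIFIED, AGREE; displayed in this seat's rows file) as `hΘ, hΘ0, hμ, hlam`; the partner datum is ONLY the donor's `hr′ : 2 ≤ rank E′(ℚ)` (Cremona 77636a1: rank 2; independent points [['-4', '1'], ['12', '39']] displayed by PARI `ellrank` in the sieve, height determinant 4.04639638479314) turned into `2 ≤ λ(X^ε(E′))` by (D1) `le_lambdaInvariant_of_le_mordellWeilRank` (the tree theorem `T^{rank} ∣ ξ`, Greenberg LNM 1716 §3);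
books `2 + 3 ≤ 2 + 3`. Inputs BY NAME `h12 h41 h5 h3 hL20 hKim`; data binders as in `…_of_partnerBound_77636a1` plus `hr′`.
UNCONDITIONAL («published + certificates» tier). PER PAIR; nothing booked; BSD is not proved by any of this.
[cite: Kobayashi2003, Conjecture (p. 2), Thm. 1.2 and Thm. 4.1] [cite: GreenbergLNM1716, §3 Lemma 3.1]
[cite: Pollack2003, Def. 6.15, Prop. 6.9, 6.10 and 6.18] [cite: BDKim2009, Cor. 2.13 (p. 187)] [cite: Cremona2006, Table 1 (Cremona label 271726d1)] -/
theorem conglx6_kobayashiMainConjecture_271726d1_3_even_of_rankTwoDonor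
    (h12 : Kobayashi2003.thm12_signedSelmerDual_finite_torsion)
    (h41 : Kobayashi2003.thm41_signedCharIdeal_divisibility)
    (h5 : realPeriodRat_eq_unit_mul_plusPeriod) (h3 : realPeriodRat_eq_unit_mul_plusPeriod_three)
    (hL20 : Wuthrich2014.lemma20_surjective_threeAdic_of_semistable)
    (hKim : BDKim2009.cor213_signedLambda_add_sum_delta_eq_of_torsionIso)
    [(⟨1, -1, 1, -17696338, -28651334301⟩ : WeierstrassCurve ℚ).IsElliptic]
    [(⟨1, -1, 1, -17696338, -28651334301⟩ : WeierstrassCurve ℚ).IsGloballyMinimal]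
    [(⟨0, 0, 0, -17, -3⟩ : WeierstrassCurve ℚ).IsElliptic]
    [(⟨0, 0, 0, -17, -3⟩ : WeierstrassCurve ℚ).IsGloballyMinimal]
    [NeZero ((⟨1, -1, 1, -17696338, -28651334301⟩ : WeierstrassCurve ℚ).conductorNorm ℤ)]
    {f₀ : CuspForm (Gamma0 ((⟨1, -1, 1, -17696338, -28651334301⟩ : WeierstrassCurve ℚ).conductorNorm ℤ)) 2}
    (hf₀ : IsNewformOf (⟨1, -1, 1, -17696338, -28651334301⟩ : WeierstrassCurve ℚ) f₀)
    (hr' : 2 ≤ (⟨0, 0, 0, -17, -3⟩ : WeierstrassCurve ℚ).mordellWeilRank)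
    {Θ : IwasawaAlgebra 3}
    (hΘ : iwasawaToPowerSeries 3 Θ =
      ((mazurTateElement f₀ 3 2).map (algebraMap ℚ ℚ_[3]) : PowerSeries ℚ_[3]))
    (hΘ0 : Θ ≠ 0) (hμ : mu Θ = 0) (hlam : lam Θ = (cyclotomicOmegaMinus 3 2).natDegree + 2) :
    KobayashiMainConjecture (⟨1, -1, 1, -17696338, -28651334301⟩ : WeierstrassCurve ℚ) 3 1 := by
  have hI : integralModelInt (⟨1, -1, 1, -17696338, -28651334301⟩ : WeierstrassCurve ℚ) = ⟨1, -1, 1, -17696338, -28651334301⟩ :=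
    integralModelInt_eq_of_map_eq _ (map_mk_int 1 (-1) 1 (-17696338) (-28651334301))
  have hp2 : (3 : ℕ) ≠ 2 := by decide
  have hn := natCard_point_eq_of_countPoints 1 (-1) 1 (-17696338) (-28651334301) 3 hp2 (by decide) x2_countPoints_271726d1_3
  have hSS : GoodSS (⟨1, -1, 1, -17696338, -28651334301⟩ : WeierstrassCurve ℚ) 3 :=
    goodSS_of_intModel 3 hI (by decide) hn (by norm_num)
  have hap : (⟨1, -1, 1, -17696338, -28651334301⟩ : WeierstrassCurve ℚ).frobeniusTrace 3 = 0 := by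
    rw [frobeniusTrace_eq hI hn]; norm_num
  exact conglx6_kobayashiMainConjecture_271726d1_3_of_partnerBound_77636a1 h12 h41 h5 h3 hL20 hKim hf₀ 1
    (fun L hL ↦ lam_signed_one_eq_of_mazurTate' hp2 hf₀ hSS.1 hap hL (by decide) hΘ hΘ0 hμ hlam)
    (le_lambdaInvariant_of_le_mordellWeilRank (p := 3) 1 hr')
    (by norm_num)

end Summit.BirchSwinnertonDyer.BirchSwinnertonDyer.Theorems.CongruenceRoad

end
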